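import Mathlib.Algebra.Module.BigOperators
import Mathlib.Analysis.Normed.Module.Basic
import Mathlib.Analysis.Normed.Lp.PiLp
import Mathlib.Analysis.SpecialFunctions.Pow.Real
import Literature.Geometry.MetricEmbeddings.HeisenbergKoranyi
import HarnessLib

/-!
# From quantitative central collapse on `ℍ` to the `L₁`-distortion of word balls of `ℍ(ℤ)`
(the transport step of [CKN, §1.1] for `CheegerKleinerNaor2011_wordBall_l1Distortion`)

Family `pnp`, layer `Literature/Geometry/MetricEmbeddings`; second sibling proofs file of
`HeisenbergL1.lean` (theorems only). Source read: J. Cheeger, B. Kleiner, A. Naor, *Compression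
bounds for Lipschitz maps from the Heisenberg group to `L₁`*, Acta Math. 207 (2011) 291–373 =
arXiv:0910.2026, §1.1, arXiv pp. 4–6, in particular p. 5: "We emphasize at the outset that our
results in the discrete case are obtained (without difficulty) directly from the corresponding
statements in the continuous case, and not by a 'discretization' of their proofs", and p. 6: "We
close this subsection by explaining how Corollaries 1.3 and 1.2 are deduced from Theorem 1.1. A key
point is to pass from the discrete settings of these corollaries to the continuous setting of
Theorem 1.1 via a Lipschitz extension theorem. […] Additionally, the homotheties `A_R(a,b,c) =
(Ra,Rb,R²c)` are used to convert information from Theorem 1.1 concerning small scales, into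
information concerning large scales. […] The map `f` can be extended to a map `f̃ : ℍ → L₁` whose
Lipschitz constant with respect to `d^ℍ` satisfies `Lip(f̃) ≲ 1`. This fact follows from the general
result of [LN05] […] but in the present simpler setting it also follows from a straightforward
partition of unity argument. Fix `R > 1` and define `g_R : B_1 → L₁` by `g_R(x) = f̃(δ_R(x))/R` […]
an application of Theorem 1.1 shows that there exist `x, y ∈ ℍ` such that `R ≳ d^ℍ(x,y) ≳ εR` and
`‖f̃(x) − f̃(y)‖ ≲ d^ℍ(x,y)/(log(1/ε))^δ`. Choose `ε = 1/√R`. Since there exist `a, b ∈ ℤ³` such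
that `d^ℍ(a,x) ≲ 1` and `d^ℍ(b,y) ≲ 1` […]".

PROVED here (no named facts; the continuous group is `HeisK` of `HeisenbergKoranyi.lean` with the
Cygan–Korányi metric `d_K`, bi-Lipschitz to `d^ℍ`, its dilations `HeisK.dilate` and lattice
`HeisK.ofInt : ℤ³ → ℍ` with `d_K ≤ 3 d_W`, `d_W ≤ 20 d_K`, `3`-density):

* `exists_pou_extension` — the "straightforward partition of unity argument" in a general metric
  space: a `K`-Lipschitz map from a finite, `a`-dense, uniformly locally finite (`≤ M` points in
  `3a`-balls) subset into a normed space has a normalised-bump average which is `3Ka`-close to it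
  and `8MK`-Lipschitz at scale `a`;
* `HeisK.exists_lipschitz_extension` — step (iii): a map on the lattice points of the word ball
  `𝔅_r`, `K`-Lipschitz for `d_K`, extends to a `ΛK`-Lipschitz map on the Korányi ball `B̄_{ρ}(1)`
  (`r ≥ 20(121ρ + 366)`), `Λ = 1500·#B_{240}` (local finiteness from the growth bound
  `ncard_wordBall_le`; local-to-global along word geodesics, `d_K` not being a length metric);
* `CheegerKleinerNaor2011_wordBall_l1Distortion.of_centralCollapse` — the deduction itself: the
  named fact follows from the weak PAIR FORM of [CKN Thm. 1.1] (its "In particular" clause) for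
  `ℓ₁^N`-valued `1`-Lipschitz maps on the unit ball of `(ℍ, d_K)`, stated inline as the hypothesis
  (rescaling by `δ_{√r}`, `ε = r^{-1/4}`, nearest lattice points; `D ≥ κ (log r)^{min(δ,1)}`).

NOT here: Theorem 1.1 itself ([CKN] §§3–12: cut measures, perimeter, the kinematic formula,
classification and quantitative stability of monotone sets), which is what remains of the discharge
of `CheegerKleinerNaor2011_wordBall_l1Distortion`; the Carnot–Carathéodory metric; `L₁(μ)` targets
(only `ℓ₁^N`, which is all the named fact quantifies over).

## References

* [CheegerKleinerNaor2011] J. Cheeger, B. Kleiner, A. Naor, Acta Math. 207 (2011) 291–373, §1.1,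
  Thm. 1.1, Cor. 1.2 and the deduction on arXiv p. 6 (arXiv:0910.2026).
* [Cygan1981] J. Cygan, Proc. AMS 83 (1981) 69–70 (the metric `d_K`).
-/

noncomputable section

open scoped BigOperators

namespace Literature.Geometry.MetricEmbeddings

/-! ### 1. Partition-of-unity Lipschitz extension (general metric spaces) -/

section PartitionOfUnity

variable {X : Type*} [PseudoMetricSpace X] {E : Type*} [NormedAddCommGroup E] [NormedSpace ℝ E]

/-- **Partition-of-unity Lipschitz extension** (the "straightforward partition of unity
argument" of [CKN §1.1, p. 6]; the elementary discrete case of the Lee–Naor extension theorem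
for doubling subsets). Let `S` be a finite subset of a metric space `X`, `F` a map into a
normed space which is `K`-Lipschitz on `S`, and `U ⊆ X` a region on which `S` is `a`-dense and
`a`-uniformly locally finite (at most `M` points of `S` in any ball of radius `3a` centred in
`U`). Then the normalised bump average `G x = (∑ ψ_s(x))⁻¹ ∑ ψ_s(x) F(s)`,
`ψ_s(x) = max (2a − d(x,s)) 0`, is within `3Ka` of `F` at scale `a` and is `8MK`-Lipschitz on
`U` at scale `a`. [cite: CheegerKleinerNaor2011, §1.1 (arXiv p. 6)] -/
theorem exists_pou_extension (S : Finset X) (F : X → E) {K a : ℝ} (hK : 0 ≤ K) (ha : 0 < a)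
    (M : ℕ) (U : Set X)
    (hF : ∀ s ∈ S, ∀ t ∈ S, ‖F s - F t‖ ≤ K * dist s t)
    (hdense : ∀ x ∈ U, ∃ s ∈ S, dist x s ≤ a)
    (hcard : ∀ x ∈ U, (S.filter fun s => dist x s < 3 * a).card ≤ M) :
    ∃ G : X → E,
      (∀ x ∈ U, ∀ s ∈ S, dist x s ≤ a → ‖G x - F s‖ ≤ 3 * K * a) ∧
      (∀ x ∈ U, ∀ y ∈ U, dist x y ≤ a → ‖G x - G y‖ ≤ 8 * M * K * dist x y) := by
  obtain ⟨ψ, hψ⟩ : ∃ ψ : X → X → ℝ, ψ = fun s x => max (2 * a - dist x s) 0 := ⟨_, rfl⟩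
  obtain ⟨Z, hZ⟩ : ∃ Z : X → ℝ, Z = fun x => ∑ s ∈ S, ψ s x := ⟨_, rfl⟩
  have hψ_nonneg : ∀ s x, 0 ≤ ψ s x := fun s x => by rw [hψ]; exact le_max_right _ _
  have hψ_eq_zero : ∀ s x, 2 * a ≤ dist x s → ψ s x = 0 := fun s x h => by
    rw [hψ]; exact max_eq_right (by linarith)
  have hψ_pos_imp : ∀ s x, ψ s x ≠ 0 → dist x s < 2 * a := fun s x h => by
    by_contra h'
    exact h (hψ_eq_zero s x (not_lt.mp h'))
  have hψ_ge : ∀ s x, dist x s ≤ a → a ≤ ψ s x := fun s x h => by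
    rw [hψ]; exact le_max_of_le_left (by linarith)
  have hψ_lip : ∀ s x y, |ψ s x - ψ s y| ≤ dist x y := by
    intro s x y
    rw [hψ]
    calc |max (2 * a - dist x s) 0 - max (2 * a - dist y s) 0|
          ≤ |(2 * a - dist x s) - (2 * a - dist y s)| := abs_max_sub_max_le_abs _ _ _
      _ = |dist y s - dist x s| := by ring_nf
      _ ≤ dist y x := abs_dist_sub_le _ _ _
      _ = dist x y := dist_comm _ _
  have hZ_ge : ∀ x ∈ U, a ≤ Z x := by
    intro x hx
    obtain ⟨s, hs, hxs⟩ := hdense x hx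
    rw [hZ]
    calc a ≤ ψ s x := hψ_ge s x hxs
      _ ≤ ∑ t ∈ S, ψ t x := Finset.single_le_sum (fun t _ => hψ_nonneg t x) hs
  have hZ_pos : ∀ x ∈ U, 0 < Z x := fun x hx => lt_of_lt_of_le ha (hZ_ge x hx)
  -- the weights
  obtain ⟨w, hw⟩ : ∃ w : X → X → ℝ, w = fun s x => (Z x)⁻¹ * ψ s x := ⟨_, rfl⟩
  have hw_nonneg : ∀ s x, x ∈ U → 0 ≤ w s x := fun s x hx => by
    rw [hw]; exact mul_nonneg (inv_nonneg.mpr (hZ_pos x hx).le) (hψ_nonneg s x)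
  have hw_sum : ∀ x ∈ U, ∑ s ∈ S, w s x = 1 := by
    intro x hx
    rw [hw]
    show ∑ s ∈ S, (Z x)⁻¹ * ψ s x = 1
    rw [← Finset.mul_sum, hZ]
    exact inv_mul_cancel₀ (by rw [hZ] at hZ_pos; exact (hZ_pos x hx).ne')
  refine ⟨fun x => ∑ s ∈ S, w s x • F s, ?_, ?_⟩
  · -- closeness
    intro x hx s₀ hs₀ hxs₀
    have key : ∑ s ∈ S, w s x • F s - F s₀ = ∑ s ∈ S, w s x • (F s - F s₀) := by
      have : F s₀ = ∑ s ∈ S, w s x • F s₀ := by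
        rw [← Finset.sum_smul, hw_sum x hx, one_smul]
      conv_lhs => rw [this]
      rw [← Finset.sum_sub_distrib]
      refine Finset.sum_congr rfl fun s _ => ?_
      rw [smul_sub]
    rw [key]
    calc ‖∑ s ∈ S, w s x • (F s - F s₀)‖
          ≤ ∑ s ∈ S, ‖w s x • (F s - F s₀)‖ := norm_sum_le _ _
      _ ≤ ∑ s ∈ S, w s x * (3 * K * a) := by
          refine Finset.sum_le_sum fun s hs => ?_
          rw [norm_smul, Real.norm_eq_abs, abs_of_nonneg (hw_nonneg s x hx)]
          by_cases h0 : ψ s x = 0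
          · have : w s x = 0 := by rw [hw]; simp [h0]
            simp [this]
          · refine mul_le_mul_of_nonneg_left ?_ (hw_nonneg s x hx)
            have hd : dist s s₀ ≤ 3 * a := by
              have h1 := hψ_pos_imp s x h0
              have := dist_triangle s x s₀
              rw [dist_comm s x] at this
              linarith
            calc ‖F s - F s₀‖ ≤ K * dist s s₀ := hF s hs s₀ hs₀
              _ ≤ K * (3 * a) := mul_le_mul_of_nonneg_left hd hK
              _ = 3 * K * a := by ring
      _ = 3 * K * a := by rw [← Finset.sum_mul, hw_sum x hx, one_mul]
  · -- local Lipschitz bound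
    intro x hx y hy hxy
    obtain ⟨s₀, hs₀, hxs₀⟩ := hdense x hx
    have expand : ∀ z ∈ U, ∑ s ∈ S, w s z • F s = F s₀ + ∑ s ∈ S, w s z • (F s - F s₀) := by
      intro z hz
      have : F s₀ = ∑ s ∈ S, w s z • F s₀ := by
        rw [← Finset.sum_smul, hw_sum z hz, one_smul]
      rw [← sub_eq_iff_eq_add', this, ← Finset.sum_sub_distrib]
      refine Finset.sum_congr rfl fun s _ => ?_
      rw [← this, smul_sub]
    have hdiff : ∑ s ∈ S, w s x • F s - ∑ s ∈ S, w s y • F s =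
        ∑ s ∈ S, (w s x - w s y) • (F s - F s₀) := by
      rw [expand x hx, expand y hy, add_sub_add_left_eq_sub, ← Finset.sum_sub_distrib]
      refine Finset.sum_congr rfl fun s _ => ?_
      rw [sub_smul]
    -- Lipschitz bound for the un-normalised weights, summed
    have hsumψ : ∑ s ∈ S, |ψ s x - ψ s y| ≤ M * dist x y := by
      have hvanish : ∀ s ∈ S, s ∉ S.filter (fun s => dist x s < 3 * a) → |ψ s x - ψ s y| = 0 := by
        intro s hs hs'
        rw [Finset.mem_filter, not_and] at hs'
        have h3 : 3 * a ≤ dist x s := not_lt.mp (hs' hs)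
        have hx0 : ψ s x = 0 := hψ_eq_zero s x (by linarith)
        have hy0 : ψ s y = 0 := by
          refine hψ_eq_zero s y ?_
          have := dist_triangle x y s
          linarith
        rw [hx0, hy0, sub_zero, abs_zero]
      rw [← Finset.sum_filter_of_ne (p := fun s => dist x s < 3 * a) (by
        intro s hs hne
        by_contra hcon
        exact hne (hvanish s hs (by rw [Finset.mem_filter, not_and]; exact fun _ => hcon)))]
      calc ∑ s ∈ S.filter (fun s => dist x s < 3 * a), |ψ s x - ψ s y|
            ≤ ∑ s ∈ S.filter (fun s => dist x s < 3 * a), dist x y :=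
              Finset.sum_le_sum fun s _ => hψ_lip s x y
        _ = (S.filter (fun s => dist x s < 3 * a)).card * dist x y := by
              rw [Finset.sum_const, nsmul_eq_mul]
        _ ≤ M * dist x y := by
              exact mul_le_mul_of_nonneg_right (by exact_mod_cast hcard x hx) dist_nonneg
    have hZlip : |Z x - Z y| ≤ M * dist x y := by
      rw [hZ]
      show |∑ s ∈ S, ψ s x - ∑ s ∈ S, ψ s y| ≤ M * dist x y
      rw [← Finset.sum_sub_distrib]
      exact (Finset.abs_sum_le_sum_abs _ _).trans hsumψ
    have hZx := hZ_pos x hx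
    have hZy := hZ_pos y hy
    -- Lipschitz bound for the normalised weights, summed
    have hsumw : ∑ s ∈ S, |w s x - w s y| ≤ 2 * M * dist x y / a := by
      have hterm : ∀ s, |w s x - w s y| ≤
          (Z x)⁻¹ * |ψ s x - ψ s y| + (Z x)⁻¹ * ((Z y)⁻¹ * ψ s y) * |Z x - Z y| := by
        intro s
        rw [hw]
        show |(Z x)⁻¹ * ψ s x - (Z y)⁻¹ * ψ s y| ≤
          (Z x)⁻¹ * |ψ s x - ψ s y| + (Z x)⁻¹ * ((Z y)⁻¹ * ψ s y) * |Z x - Z y|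
        have hid : (Z x)⁻¹ * ψ s x - (Z y)⁻¹ * ψ s y =
            (Z x)⁻¹ * (ψ s x - ψ s y) + (Z x)⁻¹ * ((Z y)⁻¹ * ψ s y) * (Z y - Z x) := by
          field_simp
          ring
        rw [hid]
        calc |(Z x)⁻¹ * (ψ s x - ψ s y) + (Z x)⁻¹ * ((Z y)⁻¹ * ψ s y) * (Z y - Z x)|
              ≤ |(Z x)⁻¹ * (ψ s x - ψ s y)| + |(Z x)⁻¹ * ((Z y)⁻¹ * ψ s y) * (Z y - Z x)| :=
                abs_add_le _ _
          _ = (Z x)⁻¹ * |ψ s x - ψ s y| + (Z x)⁻¹ * ((Z y)⁻¹ * ψ s y) * |Z x - Z y| := by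
                rw [abs_mul, abs_mul, abs_of_pos (inv_pos.mpr hZx), abs_sub_comm (Z y),
                  abs_of_nonneg (mul_nonneg (inv_pos.mpr hZx).le
                    (mul_nonneg (inv_pos.mpr hZy).le (hψ_nonneg s y)))]
      have hwy1 : ∑ s ∈ S, (Z y)⁻¹ * ψ s y = 1 := by
        have := hw_sum y hy
        rw [hw] at this
        exact this
      calc ∑ s ∈ S, |w s x - w s y|
            ≤ ∑ s ∈ S, ((Z x)⁻¹ * |ψ s x - ψ s y| + (Z x)⁻¹ * ((Z y)⁻¹ * ψ s y) * |Z x - Z y|) :=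
              Finset.sum_le_sum fun s _ => hterm s
        _ = (Z x)⁻¹ * ∑ s ∈ S, |ψ s x - ψ s y| + (Z x)⁻¹ * |Z x - Z y| := by
              rw [Finset.sum_add_distrib, ← Finset.mul_sum, ← Finset.sum_mul, ← Finset.mul_sum,
                hwy1, mul_one]
        _ ≤ (Z x)⁻¹ * (M * dist x y) + (Z x)⁻¹ * (M * dist x y) := by
              gcongr
        _ = 2 * M * dist x y / Z x := by ring
        _ ≤ 2 * M * dist x y / a := by
              refine div_le_div_of_nonneg_left (by positivity) ha (hZ_ge x hx)
    -- assemble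
    show ‖∑ s ∈ S, w s x • F s - ∑ s ∈ S, w s y • F s‖ ≤ 8 * M * K * dist x y
    rw [hdiff]
    calc ‖∑ s ∈ S, (w s x - w s y) • (F s - F s₀)‖
          ≤ ∑ s ∈ S, ‖(w s x - w s y) • (F s - F s₀)‖ := norm_sum_le _ _
      _ ≤ ∑ s ∈ S, |w s x - w s y| * (4 * K * a) := by
          refine Finset.sum_le_sum fun s hs => ?_
          rw [norm_smul, Real.norm_eq_abs]
          by_cases h0 : ψ s x = 0 ∧ ψ s y = 0
          · have : w s x - w s y = 0 := by rw [hw]; simp [h0.1, h0.2]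
            simp [this]
          · refine mul_le_mul_of_nonneg_left ?_ (abs_nonneg _)
            have hd : dist s s₀ ≤ 4 * a := by
              have hxs : dist x s < 3 * a := by
                rcases not_and_or.mp h0 with h | h
                · linarith [hψ_pos_imp s x h]
                · have := dist_triangle x y s
                  linarith [hψ_pos_imp s y h]
              have := dist_triangle s x s₀
              rw [dist_comm s x] at this
              linarith
            calc ‖F s - F s₀‖ ≤ K * dist s s₀ := hF s hs s₀ hs₀
              _ ≤ K * (4 * a) := mul_le_mul_of_nonneg_left hd hK
              _ = 4 * K * a := by ring
      _ = (∑ s ∈ S, |w s x - w s y|) * (4 * K * a) := by rw [Finset.sum_mul]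
      _ ≤ (2 * M * dist x y / a) * (4 * K * a) :=
          mul_le_mul_of_nonneg_right hsumw (by positivity)
      _ = 8 * M * K * dist x y := by field_simp; ring

end PartitionOfUnity

/-! ### 2. Lipschitz extension from the lattice `ℍ(ℤ)` to Korányi balls of `ℍ` -/

variable {E : Type*} [NormedAddCommGroup E] [NormedSpace ℝ E]

namespace HeisK

/-- Distance from the identity scales under dilations: `d_K(1, δ_s x) = s·d_K(1, x)` (`s ≥ 0`).
[cite: CheegerKleinerNaor2011, §1.1 (arXiv p. 6)] -/
theorem dist_one_dilate {s : ℝ} (hs : 0 ≤ s) (x : HeisK) : dist 1 (dilate s x) = s * dist 1 x := by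
  conv_lhs => rw [← dilate_one s, dist_dilate, abs_of_nonneg hs]


/-- Left translation recovers `h` from the coordinates of `g⁻¹h`.
[cite: CheegerKleinerNaor2011, §1.1 (arXiv p. 6)] -/
theorem heisMul_quot (g h : ℤ × ℤ × ℤ) :
    heisMul g (h.1 - g.1, h.2.1 - g.2.1, (h.2.2 - g.2.2) - g.1 * (h.2.1 - g.2.1)) = h := by
  obtain ⟨a, b, c⟩ := g
  obtain ⟨a', b', c'⟩ := h
  simp only [heisMul, Prod.mk.injEq]
  refine ⟨by ring, by ring, by ring⟩

/-- A lattice point at Korányi distance `≤ ρ` from the identity lies in the word ball of any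
radius `r ≥ 20ρ` (`d_W ≤ 20 d_K`). [cite: CheegerKleinerNaor2011, §1.1 (arXiv p. 6)] -/
theorem mem_wordBall_of_dist_one_le {g : ℤ × ℤ × ℤ} {ρ : ℝ} {r : ℕ}
    (hg : dist (1 : HeisK) (ofInt g) ≤ ρ) (hr : 20 * ρ ≤ r) : g ∈ wordBall r := by
  rw [mem_wordBall_iff_dist_le]
  have h1 := dist_le_dist_ofInt (0, 0, 0) g
  rw [ofInt_zero] at h1
  have : (cayleyGraph.dist (0, 0, 0) g : ℝ) ≤ r := by linarith
  exact_mod_cast this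

/-- The lattice points of an open Korányi ball of radius `9` are contained in a left translate
of (the image of) the word ball `𝔅_{240}`. [cite: CheegerKleinerNaor2011, §1.1 (arXiv p. 6)] -/
theorem lattice_ball_subset (x : HeisK) : ∃ g₀ : ℤ × ℤ × ℤ,
    {s : HeisK | dist x s < 9 ∧ ∃ g, ofInt g = s} ⊆
      (fun k => ofInt (heisMul g₀ k)) '' wordBall 240 := by
  obtain ⟨g₀, hg₀⟩ := exists_ofInt_dist_le x
  refine ⟨g₀, ?_⟩
  rintro s ⟨hsx, g, rfl⟩
  refine ⟨(g.1 - g₀.1, g.2.1 - g₀.2.1, (g.2.2 - g₀.2.2) - g₀.1 * (g.2.1 - g₀.2.1)), ?_, ?_⟩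
  · rw [mem_wordBall_iff_dist_le, ← dist_eq_dist_zero g₀ g]
    have h1 : (cayleyGraph.dist g₀ g : ℝ) ≤ 20 * dist (ofInt g₀) (ofInt g) :=
      dist_le_dist_ofInt g₀ g
    have h2 : dist (ofInt g₀) (ofInt g) ≤ 12 := by
      have := dist_triangle (ofInt g₀) x (ofInt g)
      linarith
    have : (cayleyGraph.dist g₀ g : ℝ) ≤ 240 := by linarith
    exact_mod_cast this
  · show ofInt (heisMul g₀ _) = ofInt g
    rw [heisMul_quot]

/-- The lattice points of an open Korányi ball of radius `9` form a finite set.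
[cite: CheegerKleinerNaor2011, §1.1 (arXiv p. 6)] -/
theorem finite_lattice_ball (x : HeisK) : {s : HeisK | dist x s < 9 ∧ ∃ g, ofInt g = s}.Finite := by
  obtain ⟨g₀, h⟩ := lattice_ball_subset x
  exact ((wordBall_finite 240).image _).subset h

/-- **Uniform local finiteness of the lattice**: at most `M₀ = #B_{240}`-many lattice points lie
in any open Korányi ball of radius `9`. [cite: CheegerKleinerNaor2011, §1.1 (arXiv p. 6)] -/
theorem ncard_lattice_ball_le (x : HeisK) :
    {s : HeisK | dist x s < 9 ∧ ∃ g, ofInt g = s}.ncard ≤ (2 * 240 + 1) ^ 2 * (2 * 240 ^ 2 + 1) := by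
  obtain ⟨g₀, hsub⟩ := lattice_ball_subset x
  calc {s : HeisK | dist x s < 9 ∧ ∃ g, ofInt g = s}.ncard
      ≤ ((fun k => ofInt (heisMul g₀ k)) '' wordBall 240).ncard :=
        Set.ncard_le_ncard hsub ((wordBall_finite 240).image _)
    _ ≤ (wordBall 240).ncard := Set.ncard_image_le (wordBall_finite 240)
    _ ≤ (2 * 240 + 1) ^ 2 * (2 * 240 ^ 2 + 1) := ncard_wordBall_le 240

/-- **Lipschitz extension from the lattice to a Korányi ball** (step (iii) of the deduction of
[CKN Cor. 1.2] from [CKN Thm. 1.1], arXiv p. 6: "The map `f` can be extended to a map `f̃ : ℍ → L₁`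
whose Lipschitz constant with respect to `d^ℍ` satisfies `Lip(f̃) ≲ 1` … in the present simpler
setting it also follows from a straightforward partition of unity argument"). If `F` is
`K`-Lipschitz for `d_K` on the lattice points of the word ball `𝔅_r`, and `20(121ρ₁+366) ≤ r`,
there is `G : ℍ → E` which is `9K`-close to `F` at the lattice points of the closed Korányi ball
`B̄_{ρ₁}(1)` and `ΛK`-Lipschitz on `B̄_{ρ₁}(1)`, `Λ = 1500·#B_{240}` universal.
[cite: CheegerKleinerNaor2011, §1.1 (arXiv p. 6)] -/
theorem exists_lipschitz_extension (r : ℕ) {ρ₁ : ℝ} (hρ₁ : 0 ≤ ρ₁)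
    (hr : 20 * (121 * ρ₁ + 366) ≤ r) (F : HeisK → E) {K : ℝ} (hK : 0 ≤ K)
    (hF : ∀ g ∈ wordBall r, ∀ h ∈ wordBall r,
      ‖F (ofInt g) - F (ofInt h)‖ ≤ K * dist (ofInt g) (ofInt h)) :
    ∃ G : HeisK → E,
      (∀ g : ℤ × ℤ × ℤ, dist (1 : HeisK) (ofInt g) ≤ ρ₁ → ‖G (ofInt g) - F (ofInt g)‖ ≤ 9 * K) ∧
      (∀ x y : HeisK, dist 1 x ≤ ρ₁ → dist 1 y ≤ ρ₁ →
        ‖G x - G y‖ ≤ 1500 * ((2 * 240 + 1) ^ 2 * (2 * 240 ^ 2 + 1) : ℕ) * K * dist x y) := by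
  classical
  -- the data of the general extension lemma
  set M₀ : ℕ := (2 * 240 + 1) ^ 2 * (2 * 240 ^ 2 + 1) with hM₀
  set ρ : ℝ := 121 * ρ₁ + 363 with hρ
  set S : Finset HeisK := (wordBall_finite r).toFinset.image ofInt with hS
  set U : Set HeisK := Metric.closedBall (1 : HeisK) ρ with hU
  have hmemS : ∀ {s : HeisK}, s ∈ S ↔ ∃ g ∈ wordBall r, ofInt g = s := by
    intro s
    simp only [hS, Finset.mem_image, Set.Finite.mem_toFinset]
  have hFS : ∀ s ∈ S, ∀ t ∈ S, ‖F s - F t‖ ≤ K * dist s t := by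
    intro s hs t ht
    obtain ⟨g, hg, rfl⟩ := hmemS.mp hs
    obtain ⟨h, hh, rfl⟩ := hmemS.mp ht
    exact hF g hg h hh
  -- lattice points of `B̄_{ρ+3}(1)` are in `S`
  have hinS : ∀ g : ℤ × ℤ × ℤ, dist (1 : HeisK) (ofInt g) ≤ ρ + 3 → ofInt g ∈ S := by
    intro g hg
    exact hmemS.mpr ⟨g, mem_wordBall_of_dist_one_le hg (by rw [hρ]; linarith), rfl⟩
  have hdense : ∀ x ∈ U, ∃ s ∈ S, dist x s ≤ 3 := by
    intro x hx
    rw [hU, Metric.mem_closedBall, dist_comm] at hx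
    obtain ⟨g, hg⟩ := exists_ofInt_dist_le x
    refine ⟨ofInt g, hinS g ?_, by rwa [dist_comm]⟩
    have := dist_triangle (1 : HeisK) x (ofInt g)
    rw [dist_comm x (ofInt g)] at this
    linarith
  have hcard : ∀ x ∈ U, (S.filter fun s => dist x s < 3 * 3).card ≤ M₀ := by
    intro x _
    rw [← Set.ncard_coe_finset]
    refine le_trans (Set.ncard_le_ncard ?_ (finite_lattice_ball x)) (ncard_lattice_ball_le x)
    intro s hs
    rw [Finset.coe_filter] at hs
    obtain ⟨hsS, hsx⟩ := hs
    obtain ⟨g, _, rfl⟩ := hmemS.mp hsS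
    exact ⟨by norm_num at hsx; exact hsx, g, rfl⟩
  obtain ⟨G, hclose, hlip⟩ :=
    exists_pou_extension S F hK (by norm_num : (0 : ℝ) < 3) M₀ U hFS hdense hcard
  have hU_mem : ∀ {x : HeisK}, dist 1 x ≤ ρ → x ∈ U := fun h => by
    rw [hU, Metric.mem_closedBall, dist_comm]; exact h
  have hρ₁ρ : ρ₁ + 3 ≤ ρ := by rw [hρ]; linarith
  refine ⟨G, fun g hg => ?_, ?_⟩
  · have := hclose (ofInt g) (hU_mem (by linarith)) (ofInt g) (hinS g (by linarith))
      (by rw [dist_self]; norm_num)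
    linarith
  -- local Lipschitz bound along the edges of the Cayley graph, chained along a geodesic walk
  have M₀nn : (0 : ℝ) ≤ M₀ := by positivity
  have hwalk : ∀ (u v : ℤ × ℤ × ℤ) (p : cayleyGraph.Walk u v),
      dist (1 : HeisK) (ofInt u) + 3 * p.length ≤ ρ →
        ‖G (ofInt u) - G (ofInt v)‖ ≤ 24 * M₀ * K * p.length := by
    intro u v p
    induction p with
    | nil => intro _; simp
    | @cons u w v hadj p ih =>
      intro hfit
      rw [SimpleGraph.Walk.length_cons, Nat.cast_add, Nat.cast_one] at hfit ⊢
      have hduw : dist (ofInt u) (ofInt w) ≤ 3 := by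
        have h1 := dist_ofInt_le u w
        have h2 : cayleyGraph.dist u w = 1 := SimpleGraph.dist_eq_one_iff_adj.mpr hadj
        rw [h2, Nat.cast_one, mul_one] at h1
        exact h1
      have hlen : (0 : ℝ) ≤ p.length := Nat.cast_nonneg _
      have hu : dist (1 : HeisK) (ofInt u) ≤ ρ := by linarith
      have hw : dist (1 : HeisK) (ofInt w) + 3 * p.length ≤ ρ := by
        have := dist_triangle (1 : HeisK) (ofInt u) (ofInt w)
        linarith
      have hw' : dist (1 : HeisK) (ofInt w) ≤ ρ := by linarith
      have step := hlip (ofInt u) (hU_mem hu) (ofInt w) (hU_mem hw') hduw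
      have rest := ih hw
      calc ‖G (ofInt u) - G (ofInt v)‖
          ≤ ‖G (ofInt u) - G (ofInt w)‖ + ‖G (ofInt w) - G (ofInt v)‖ := norm_sub_le_norm_sub_add_norm_sub _ _ _
        _ ≤ 8 * M₀ * K * dist (ofInt u) (ofInt w) + 24 * M₀ * K * p.length := add_le_add step rest
        _ ≤ 8 * M₀ * K * 3 + 24 * M₀ * K * p.length := by
            gcongr
        _ = 24 * M₀ * K * (p.length + 1) := by ring
  intro x y hx hy
  by_cases hxy : dist x y ≤ 3
  · calc ‖G x - G y‖ ≤ 8 * M₀ * K * dist x y :=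
          hlip x (hU_mem (by linarith)) y (hU_mem (by linarith)) hxy
      _ ≤ 1500 * M₀ * K * dist x y := by
          have : (0 : ℝ) ≤ M₀ * K * dist x y := by positivity
          nlinarith
  rw [not_le] at hxy
  obtain ⟨gx, hgx⟩ := exists_ofInt_dist_le x
  obtain ⟨gy, hgy⟩ := exists_ofInt_dist_le y
  obtain ⟨p, hp⟩ := cayleyGraph_connected.exists_walk_length_eq_dist gx gy
  have hxy2 : dist x y ≤ 2 * ρ₁ := by
    have := dist_triangle x (1 : HeisK) y
    rw [dist_comm x 1] at this
    linarith
  have hℓ : (cayleyGraph.dist gx gy : ℝ) ≤ 20 * (dist x y + 6) := by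
    have h1 := dist_le_dist_ofInt gx gy
    have h2 : dist (ofInt gx) (ofInt gy) ≤ dist x y + 6 := by
      have := dist_triangle4 (ofInt gx) x y (ofInt gy)
      rw [dist_comm y (ofInt gy)] at this
      linarith
    linarith
  have hgx1 : dist (1 : HeisK) (ofInt gx) ≤ ρ₁ + 3 := by
    have := dist_triangle (1 : HeisK) x (ofInt gx)
    rw [dist_comm x (ofInt gx)] at this
    linarith
  have hgy1 : dist (1 : HeisK) (ofInt gy) ≤ ρ₁ + 3 := by
    have := dist_triangle (1 : HeisK) y (ofInt gy)
    rw [dist_comm y (ofInt gy)] at this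
    linarith
  have hfit : dist (1 : HeisK) (ofInt gx) + 3 * p.length ≤ ρ := by
    rw [hp, hρ]
    have : (cayleyGraph.dist gx gy : ℝ) ≤ 20 * (2 * ρ₁ + 6) := by nlinarith
    linarith
  have hmid := hwalk gx gy p hfit
  rw [hp] at hmid
  have hex : ‖G x - G (ofInt gx)‖ ≤ 8 * M₀ * K * 3 := by
    calc ‖G x - G (ofInt gx)‖ ≤ 8 * M₀ * K * dist x (ofInt gx) :=
          hlip x (hU_mem (by linarith)) (ofInt gx) (hU_mem (by linarith)) (by rwa [dist_comm])
      _ ≤ 8 * M₀ * K * 3 := by rw [dist_comm]; gcongr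
  have hey : ‖G (ofInt gy) - G y‖ ≤ 8 * M₀ * K * 3 := by
    calc ‖G (ofInt gy) - G y‖ ≤ 8 * M₀ * K * dist (ofInt gy) y :=
          hlip (ofInt gy) (hU_mem (by linarith)) y (hU_mem (by linarith)) hgy
      _ ≤ 8 * M₀ * K * 3 := by gcongr
  calc ‖G x - G y‖
      ≤ ‖G x - G (ofInt gx)‖ + ‖G (ofInt gx) - G (ofInt gy)‖ + ‖G (ofInt gy) - G y‖ := by
        have h1 := norm_sub_le_norm_sub_add_norm_sub (G x) (G (ofInt gx)) (G y)
        have h2 := norm_sub_le_norm_sub_add_norm_sub (G (ofInt gx)) (G (ofInt gy)) (G y)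
        linarith
    _ ≤ 8 * M₀ * K * 3 + 24 * M₀ * K * (cayleyGraph.dist gx gy : ℝ) + 8 * M₀ * K * 3 := by
        gcongr
    _ ≤ 8 * M₀ * K * 3 + 24 * M₀ * K * (20 * (dist x y + 6)) + 8 * M₀ * K * 3 := by
        gcongr
    _ = M₀ * K * (2928 + 480 * dist x y) := by ring
    _ ≤ M₀ * K * (1500 * dist x y) := by
        refine mul_le_mul_of_nonneg_left ?_ (by positivity)
        linarith
    _ = 1500 * M₀ * K * dist x y := by ring

end HeisK

/-! ### 3. The transport: Cor. 1.2 (word-ball form) from the pair form of Thm. 1.1 -/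

namespace CheegerKleinerNaor2011_wordBall_l1Distortion

open HeisK

/-- Step 0 of the transport: the exponent in a central-collapse bound may be decreased
(`log(1/ε) ≥ 1` for `ε < 1/4`). [cite: CheegerKleinerNaor2011, §1.1 (arXiv p. 6)] -/
theorem centralCollapse_mono {δ δ' C : ℝ} (hδ' : δ' ≤ δ)
    (H : ∀ (N : ℕ) (φ : HeisK → Fin N → ℝ),
      (∀ x ∈ Metric.ball (1 : HeisK) 1, ∀ y ∈ Metric.ball (1 : HeisK) 1,
        ∑ k, |φ x k - φ y k| ≤ dist x y) →
      ∀ ε : ℝ, 0 < ε → ε < 1 / 4 →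
        ∃ x ∈ Metric.ball (1 : HeisK) 1, ∃ y ∈ Metric.ball (1 : HeisK) 1,
          ε ≤ C * dist x y ∧ ∑ k, |φ x k - φ y k| ≤ C * dist x y / Real.log (1 / ε) ^ δ) :
    ∀ (N : ℕ) (φ : HeisK → Fin N → ℝ),
      (∀ x ∈ Metric.ball (1 : HeisK) 1, ∀ y ∈ Metric.ball (1 : HeisK) 1,
        ∑ k, |φ x k - φ y k| ≤ dist x y) →
      ∀ ε : ℝ, 0 < ε → ε < 1 / 4 →
        ∃ x ∈ Metric.ball (1 : HeisK) 1, ∃ y ∈ Metric.ball (1 : HeisK) 1,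
          ε ≤ C * dist x y ∧ ∑ k, |φ x k - φ y k| ≤ C * dist x y / Real.log (1 / ε) ^ δ' := by
  intro N φ hφ ε hε hε4
  obtain ⟨x, hx, y, hy, h1, h2⟩ := H N φ hφ ε hε hε4
  refine ⟨x, hx, y, hy, h1, h2.trans ?_⟩
  have hexp4 : Real.exp 1 < 4 := by
    have := Real.exp_one_lt_d9; norm_num at this; linarith
  have hlog : 1 ≤ Real.log (1 / ε) := by
    have h4 : 4 < 1 / ε := by rw [lt_div_iff₀ hε]; linarith
    have := Real.log_le_log (Real.exp_pos 1) (show Real.exp 1 ≤ 1 / ε by linarith)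
    rwa [Real.log_exp] at this
  refine div_le_div_of_nonneg_left (hε.le.trans h1) (Real.rpow_pos_of_pos (by linarith) _) ?_
  exact Real.rpow_le_rpow_of_exponent_le hlog hδ'

/-- Steps (iii)+(ii) of the transport: extend the lattice map to a Lipschitz map `G` on the
Korányi ball `B̄_{ρ₀+3}(1)` (values in `ℓ₁^N`), rescale by `δ_{ρ₀}` to a `1`-Lipschitz map on
`B_1(1)`, and apply central collapse at `ε = 1/t`, `t = √ρ₀`: a pair `X, Y ∈ B̄_{ρ₀}(1)` with
`d_K(X,Y) ≥ t/C` compressed by `G` by the factor `C Λ K/(log t)^δ`.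
[cite: CheegerKleinerNaor2011, §1.1 (arXiv p. 6)] -/
theorem exists_compressed_pair {δ C Λ K ρ₀ t : ℝ} {N : ℕ} (hΛ : 0 < Λ) (hK : 0 < K)
    (hρ₀ : 0 < ρ₀) (ht : t ^ 2 = ρ₀) (ht4 : 4 < t)
    (H : ∀ (φ : HeisK → Fin N → ℝ),
      (∀ x ∈ Metric.ball (1 : HeisK) 1, ∀ y ∈ Metric.ball (1 : HeisK) 1,
        ∑ k, |φ x k - φ y k| ≤ dist x y) →
      ∀ ε : ℝ, 0 < ε → ε < 1 / 4 →
        ∃ x ∈ Metric.ball (1 : HeisK) 1, ∃ y ∈ Metric.ball (1 : HeisK) 1,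
          ε ≤ C * dist x y ∧ ∑ k, |φ x k - φ y k| ≤ C * dist x y / Real.log (1 / ε) ^ δ)
    (G : HeisK → PiLp 1 (fun _ : Fin N => ℝ))
    (hGlip : ∀ x y : HeisK, dist 1 x ≤ ρ₀ + 3 → dist 1 y ≤ ρ₀ + 3 →
      ‖G x - G y‖ ≤ Λ * K * dist x y) :
    ∃ X Y : HeisK, dist 1 X ≤ ρ₀ ∧ dist 1 Y ≤ ρ₀ ∧ t ≤ C * dist X Y ∧
      ‖G X - G Y‖ ≤ Λ * K * C * dist X Y / Real.log t ^ δ := by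
  have htpos : 0 < t := by linarith
  have hΛKρ : 0 < Λ * K * ρ₀ := by positivity
  set φ : HeisK → Fin N → ℝ := fun x k => (Λ * K * ρ₀)⁻¹ * (G (dilate ρ₀ x)) k with hφ
  have hφsum : ∀ x y : HeisK,
      ∑ k, |φ x k - φ y k| = (Λ * K * ρ₀)⁻¹ * ‖G (dilate ρ₀ x) - G (dilate ρ₀ y)‖ := by
    intro x y
    rw [PiLp.norm_eq_of_L1, Finset.mul_sum]
    refine Finset.sum_congr rfl fun k _ => ?_
    simp only [hφ, PiLp.sub_apply, Real.norm_eq_abs, ← mul_sub, abs_mul,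
      abs_of_pos (inv_pos.mpr hΛKρ)]
  have hdil : ∀ {x : HeisK}, dist x 1 < 1 → dist 1 (dilate ρ₀ x) ≤ ρ₀ := by
    intro x hx
    rw [dist_one_dilate hρ₀.le, dist_comm]
    nlinarith
  have hφlip : ∀ x ∈ Metric.ball (1 : HeisK) 1, ∀ y ∈ Metric.ball (1 : HeisK) 1,
      ∑ k, |φ x k - φ y k| ≤ dist x y := by
    intro x hx y hy
    rw [Metric.mem_ball] at hx hy
    rw [hφsum]
    calc (Λ * K * ρ₀)⁻¹ * ‖G (dilate ρ₀ x) - G (dilate ρ₀ y)‖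
        ≤ (Λ * K * ρ₀)⁻¹ * (Λ * K * dist (dilate ρ₀ x) (dilate ρ₀ y)) :=
          mul_le_mul_of_nonneg_left
            (hGlip _ _ (by linarith [hdil hx]) (by linarith [hdil hy])) (inv_pos.mpr hΛKρ).le
      _ = dist x y := by
          rw [dist_dilate, abs_of_pos hρ₀]; field_simp
  have hε : (0 : ℝ) < t⁻¹ := inv_pos.mpr htpos
  have hε4 : t⁻¹ < 1 / 4 := by
    rw [one_div]; exact (inv_lt_inv₀ htpos (by norm_num)).mpr ht4
  obtain ⟨x, hx, y, hy, hxy, hcomp⟩ := H φ hφlip t⁻¹ hε hε4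
  rw [one_div, inv_inv, hφsum] at hcomp
  rw [Metric.mem_ball] at hx hy
  have hdXY : dist (dilate ρ₀ x) (dilate ρ₀ y) = ρ₀ * dist x y := by
    rw [dist_dilate, abs_of_pos hρ₀]
  refine ⟨dilate ρ₀ x, dilate ρ₀ y, hdil hx, hdil hy, ?_, ?_⟩
  · rw [hdXY, ← ht]
    have : t ^ 2 * t⁻¹ ≤ t ^ 2 * (C * dist x y) := mul_le_mul_of_nonneg_left hxy (by positivity)
    have h2 : t ^ 2 * t⁻¹ = t := by field_simp
    linarith
  · have hpow : 0 < Real.log t ^ δ := Real.rpow_pos_of_pos (Real.log_pos (by linarith)) _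
    rw [hdXY, le_div_iff₀ hpow]
    rw [le_div_iff₀ hpow] at hcomp
    have := mul_le_mul_of_nonneg_left hcomp hΛKρ.le
    calc ‖G (dilate ρ₀ x) - G (dilate ρ₀ y)‖ * Real.log t ^ δ
        = Λ * K * ρ₀ * ((Λ * K * ρ₀)⁻¹ * ‖G (dilate ρ₀ x) - G (dilate ρ₀ y)‖ * Real.log t ^ δ) := by
          field_simp
      _ ≤ Λ * K * ρ₀ * (C * dist x y) := this
      _ = Λ * K * C * (ρ₀ * dist x y) := by ring

/-- Step (i) of the transport (nearest lattice points): if `G` is `9K`-close to the lattice map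
`g ↦ f g ∈ ℓ₁^N` on `B̄_{ρ₀+3}(1)` and `ΛK`-Lipschitz there, and `f` is non-contracting for
`d_W` on `𝔅_r ⊇ B̄_{ρ₀+3}(1) ∩ ℍ(ℤ)`, then for `X, Y ∈ B̄_{ρ₀}(1)`,
`(d_K(X,Y) − 6)/3 ≤ (18 + 6Λ)K + ‖G X − G Y‖` (`d_K ≤ 3 d_W`, lattice `3`-dense).
[cite: CheegerKleinerNaor2011, §1.1 (arXiv p. 6)] -/
theorem lattice_sandwich {N r : ℕ} {f : ℤ × ℤ × ℤ → Fin N → ℝ} {K Λ ρ₀ : ℝ}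
    (hf : ∀ g h : ℤ × ℤ × ℤ, g ∈ wordBall r → h ∈ wordBall r →
      (cayleyGraph.dist g h : ℝ) ≤ ∑ k, |f g k - f h k|)
    (hr : 20 * (ρ₀ + 3) ≤ r) (hΛK : 0 ≤ Λ * K)
    (G : HeisK → PiLp 1 (fun _ : Fin N => ℝ))
    (hGclose : ∀ g : ℤ × ℤ × ℤ, dist (1 : HeisK) (ofInt g) ≤ ρ₀ + 3 →
      ‖G (ofInt g) - WithLp.toLp 1 (f g)‖ ≤ 9 * K)
    (hGlip : ∀ x y : HeisK, dist 1 x ≤ ρ₀ + 3 → dist 1 y ≤ ρ₀ + 3 →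
      ‖G x - G y‖ ≤ Λ * K * dist x y)
    {X Y : HeisK} (hX : dist 1 X ≤ ρ₀) (hY : dist 1 Y ≤ ρ₀) :
    (dist X Y - 6) / 3 ≤ (18 + 6 * Λ) * K + ‖G X - G Y‖ := by
  obtain ⟨gX, hgX⟩ := exists_ofInt_dist_le X
  obtain ⟨gY, hgY⟩ := exists_ofInt_dist_le Y
  have hgX1 : dist (1 : HeisK) (ofInt gX) ≤ ρ₀ + 3 := by
    have := dist_triangle (1 : HeisK) X (ofInt gX); rw [dist_comm X] at this; linarith
  have hgY1 : dist (1 : HeisK) (ofInt gY) ≤ ρ₀ + 3 := by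
    have := dist_triangle (1 : HeisK) Y (ofInt gY); rw [dist_comm Y] at this; linarith
  have hnorm : ‖WithLp.toLp 1 (f gX) - WithLp.toLp 1 (f gY)‖ = ∑ k, |f gX k - f gY k| := by
    rw [← WithLp.toLp_sub, PiLp.norm_eq_of_L1]; rfl
  -- lower bound from non-contraction and `d_K ≤ 3 d_W`
  have hlower : (dist X Y - 6) / 3 ≤ ∑ k, |f gX k - f gY k| := by
    have h1 := hf gX gY (mem_wordBall_of_dist_one_le hgX1 hr) (mem_wordBall_of_dist_one_le hgY1 hr)
    have h2 := dist_ofInt_le gX gY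
    have h3 : dist X Y ≤ dist (ofInt gX) (ofInt gY) + 6 := by
      have := dist_triangle4 X (ofInt gX) (ofInt gY) Y
      rw [dist_comm X (ofInt gX)] at this
      linarith
    linarith
  -- upper bound through `G`
  have h3 : ‖G (ofInt gX) - G X‖ ≤ Λ * K * 3 :=
    (hGlip (ofInt gX) X hgX1 (by linarith)).trans (mul_le_mul_of_nonneg_left hgX hΛK)
  have h4 : ‖G Y - G (ofInt gY)‖ ≤ Λ * K * 3 :=
    (hGlip Y (ofInt gY) (by linarith) hgY1).trans
      (mul_le_mul_of_nonneg_left (by rwa [dist_comm]) hΛK)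
  have hupper : ∑ k, |f gX k - f gY k| ≤ (18 + 6 * Λ) * K + ‖G X - G Y‖ := by
    rw [← hnorm]
    have h1 := hGclose gX hgX1
    have h2 := hGclose gY hgY1
    rw [norm_sub_rev] at h1
    have a1 := norm_sub_le_norm_sub_add_norm_sub (WithLp.toLp 1 (f gX)) (G (ofInt gX))
      (WithLp.toLp 1 (f gY))
    have a2 := norm_sub_le_norm_sub_add_norm_sub (G (ofInt gX)) (G X) (WithLp.toLp 1 (f gY))
    have a3 := norm_sub_le_norm_sub_add_norm_sub (G X) (G Y) (WithLp.toLp 1 (f gY))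
    have a4 := norm_sub_le_norm_sub_add_norm_sub (G Y) (G (ofInt gY)) (WithLp.toLp 1 (f gY))
    linarith
  exact hlower.trans hupper

/-- The arithmetic of the transport: from `(d−6)/3 ≤ (18+6Λ)·20D + Λ·20D·C·d/P`, `P ≤ C d`,
`D ≥ 1` one gets `P ≤ C(1086 + 420Λ)·D`. [cite: CheegerKleinerNaor2011, §1.1 (arXiv p. 6)] -/
theorem arith_of_sandwich {d P C D Λ : ℝ} (hd : 0 < d) (hP : 0 < P) (hC : 0 < C) (hD : 1 ≤ D)
    (hΛ : 0 ≤ Λ) (hPd : P ≤ C * d)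
    (h : (d - 6) / 3 ≤ (18 + 6 * Λ) * (20 * D) + Λ * (20 * D) * C * d / P) :
    P ≤ C * (1086 + 420 * Λ) * D := by
  rw [div_le_iff₀ (by norm_num : (0:ℝ) < 3)] at h
  have h1 : Λ * (20 * D) * C * d / P * 3 * P = 60 * Λ * D * C * d := by field_simp; ring
  have h3 : (d - 6) * P ≤ (18 + 6 * Λ) * (20 * D) * 3 * P + 60 * Λ * D * C * d := by
    have := mul_le_mul_of_nonneg_right h hP.le
    rwa [add_mul, add_mul, h1] at this
  have hD0 : 0 ≤ D := by linarith
  have e1 : 6 * P ≤ 6 * (C * d) * D := by nlinarith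
  have e2 : (18 + 6 * Λ) * (20 * D) * 3 * P ≤ (18 + 6 * Λ) * (20 * D) * 3 * (C * d) :=
    mul_le_mul_of_nonneg_left hPd (by positivity)
  have key : d * P ≤ d * (C * (1086 + 420 * Λ) * D) := by nlinarith
  exact le_of_mul_le_mul_left key hd

/-- The transport for large radii: under central collapse with exponent `δ ≤ 1` and constant
`C`, an embedding of `𝔅_r` (`r ≥ 2427²`) into `ℓ₁^N` with `d_W ≤ ‖·‖₁ ≤ D d_W` has
`(¼ log r)^δ = (log r^{1/4})^δ ≤ C(1086 + 420Λ) D`, `Λ = 1500·#B_{240}`.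
[cite: CheegerKleinerNaor2011, §1.1 (arXiv p. 6)] -/
theorem large_radius {δ C : ℝ} (hδ1 : δ ≤ 1) (hC : 0 < C)
    (H : ∀ (N : ℕ) (φ : HeisK → Fin N → ℝ),
      (∀ x ∈ Metric.ball (1 : HeisK) 1, ∀ y ∈ Metric.ball (1 : HeisK) 1,
        ∑ k, |φ x k - φ y k| ≤ dist x y) →
      ∀ ε : ℝ, 0 < ε → ε < 1 / 4 →
        ∃ x ∈ Metric.ball (1 : HeisK) 1, ∃ y ∈ Metric.ball (1 : HeisK) 1,
          ε ≤ C * dist x y ∧ ∑ k, |φ x k - φ y k| ≤ C * dist x y / Real.log (1 / ε) ^ δ)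
    {r : ℕ} (hr : (2427 : ℝ) ^ 2 ≤ r) {N : ℕ} {f : ℤ × ℤ × ℤ → Fin N → ℝ} {D : ℝ}
    (hf : ∀ g h : ℤ × ℤ × ℤ, g ∈ wordBall r → h ∈ wordBall r →
      (cayleyGraph.dist g h : ℝ) ≤ ∑ k, |f g k - f h k| ∧
        ∑ k, |f g k - f h k| ≤ D * (cayleyGraph.dist g h : ℝ))
    (hD : 1 ≤ D) :
    Real.log (Real.sqrt (Real.sqrt r)) ^ δ ≤
      C * (1086 + 420 * (1500 * ((2 * 240 + 1) ^ 2 * (2 * 240 ^ 2 + 1) : ℕ))) * D := by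
  classical
  set Λ : ℝ := 1500 * ((2 * 240 + 1) ^ 2 * (2 * 240 ^ 2 + 1) : ℕ) with hΛ
  have hΛpos : 0 < Λ := by rw [hΛ]; positivity
  have hr_pos : (0 : ℝ) < r := by nlinarith
  set ρ₀ : ℝ := Real.sqrt r with hρ₀
  have hρ₀_ge : 2427 ≤ ρ₀ := by
    rw [hρ₀, Real.le_sqrt (by norm_num) hr_pos.le]; exact hr
  have hρ₀pos : 0 < ρ₀ := by linarith
  have hρ₀sq : ρ₀ ^ 2 = r := Real.sq_sqrt hr_pos.le
  set t : ℝ := Real.sqrt ρ₀ with ht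
  have ht_ge : 49 ≤ t := by
    rw [ht, Real.le_sqrt (by norm_num) hρ₀pos.le]; nlinarith
  have htpos : 0 < t := by linarith
  have htsq : t ^ 2 = ρ₀ := Real.sq_sqrt hρ₀pos.le
  have hexp3 : Real.exp 1 < 3 := by
    have := Real.exp_one_lt_d9; norm_num at this; linarith
  have hlogt1 : 1 ≤ Real.log t := by
    have := Real.log_le_log (Real.exp_pos 1) (show Real.exp 1 ≤ t by linarith)
    rwa [Real.log_exp] at this
  -- Step (iii): the lattice map, valued in `ℓ₁^N`, is `20 D`-Lipschitz for `d_K` on `𝔅_r`; extend.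
  set F : HeisK → PiLp 1 (fun _ : Fin N => ℝ) :=
    fun p => WithLp.toLp 1 (f (Function.invFun ofInt p)) with hF
  have hFapply : ∀ g : ℤ × ℤ × ℤ, F (ofInt g) = WithLp.toLp 1 (f g) := by
    intro g
    simp only [hF, Function.leftInverse_invFun ofInt_injective g]
  have hFnorm : ∀ g h : ℤ × ℤ × ℤ, ‖F (ofInt g) - F (ofInt h)‖ = ∑ k, |f g k - f h k| := by
    intro g h
    rw [hFapply, hFapply, ← WithLp.toLp_sub, PiLp.norm_eq_of_L1]
    rfl
  set K : ℝ := 20 * D with hK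
  have hKpos : 0 < K := by rw [hK]; linarith
  have hFlip : ∀ g ∈ wordBall r, ∀ h ∈ wordBall r,
      ‖F (ofInt g) - F (ofInt h)‖ ≤ K * dist (ofInt g) (ofInt h) := by
    intro g hg h hh
    rw [hFnorm]
    calc ∑ k, |f g k - f h k| ≤ D * (cayleyGraph.dist g h : ℝ) := (hf g h hg hh).2
      _ ≤ D * (20 * dist (ofInt g) (ofInt h)) :=
          mul_le_mul_of_nonneg_left (dist_le_dist_ofInt g h) (by linarith)
      _ = K * dist (ofInt g) (ofInt h) := by rw [hK]; ring
  have hfit : 20 * (121 * (ρ₀ + 3) + 366) ≤ (r : ℝ) := by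
    rw [← hρ₀sq]; nlinarith
  obtain ⟨G, hGclose, hGlip⟩ :=
    exists_lipschitz_extension r (by linarith : (0 : ℝ) ≤ ρ₀ + 3) hfit F hKpos.le hFlip
  rw [← hΛ] at hGlip
  -- Step (ii)+(iv): rescale and apply central collapse at `ε = 1/t`.
  obtain ⟨X, Y, hX, hY, htd, hcomp⟩ :=
    exists_compressed_pair (δ := δ) hΛpos hKpos hρ₀pos htsq (by linarith) (H N) G hGlip
  -- Step (i): nearest lattice points.
  have hGclose' : ∀ g : ℤ × ℤ × ℤ, dist (1 : HeisK) (ofInt g) ≤ ρ₀ + 3 →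
      ‖G (ofInt g) - WithLp.toLp 1 (f g)‖ ≤ 9 * K := by
    intro g hg; rw [← hFapply]; exact hGclose g hg
  have hsand := lattice_sandwich (fun g h hg hh => (hf g h hg hh).1)
    (show 20 * (ρ₀ + 3) ≤ (r : ℝ) by rw [← hρ₀sq]; nlinarith)
    (by positivity : (0 : ℝ) ≤ Λ * K) G hGclose' hGlip hX hY
  -- arithmetic
  have hpow : 0 < Real.log t ^ δ := Real.rpow_pos_of_pos (by linarith) _
  have hpow_le_t : Real.log t ^ δ ≤ t := by
    calc Real.log t ^ δ ≤ Real.log t ^ (1 : ℝ) := Real.rpow_le_rpow_of_exponent_le hlogt1 hδ1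
      _ = Real.log t := Real.rpow_one _
      _ ≤ t := (Real.log_le_sub_one_of_pos htpos).trans (by linarith)
  have hd_pos : 0 < dist X Y := by
    by_contra hcon
    rw [not_lt] at hcon
    nlinarith
  have hPd : Real.log t ^ δ ≤ C * dist X Y := hpow_le_t.trans htd
  refine arith_of_sandwich hd_pos hpow hC hD hΛpos.le hPd ?_
  calc (dist X Y - 6) / 3 ≤ (18 + 6 * Λ) * K + ‖G X - G Y‖ := hsand
    _ ≤ (18 + 6 * Λ) * K + Λ * K * C * dist X Y / Real.log t ^ δ := by linarith
    _ = (18 + 6 * Λ) * (20 * D) + Λ * (20 * D) * C * dist X Y / Real.log t ^ δ := by rw [hK]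

/-- **Transport theorem** ([CKN §1.1, arXiv p. 6]: "our results in the discrete case are obtained
(without difficulty) directly from the corresponding statements in the continuous case … via a
Lipschitz extension theorem … the homotheties `A_R` are used to convert information from
Theorem 1.1 concerning small scales, into information concerning large scales"). The named fact
`CheegerKleinerNaor2011_wordBall_l1Distortion` (= [CKN Cor. 1.2] in the word-ball form) follows
from the following weak, pair form of **quantitative central collapse** [CKN Thm. 1.1, "In
particular, compression by a factor … is guaranteed to occur for a pair of points whose distance is
`≳ …`"] on the continuous Heisenberg group `ℍ` with the Cygan–Korányi metric `d_K` (bi-Lipschitz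
to `d^ℍ`), for `ℓ₁^N`-valued maps: there are `δ > 0` and `C > 0` such that every map
`φ : B_1(1) → ℓ₁^N` which is `1`-Lipschitz for `d_K` compresses, for every `ε ∈ (0, ¼)`, some pair
`x, y ∈ B_1(1)` with `d_K(x,y) ≥ ε/C` by the factor `C/(log(1/ε))^δ`.
The proof is the printed one: Lipschitz extension of the lattice map to `ℍ` by a partition of
unity (`HeisK.exists_lipschitz_extension`), rescaling by the dilation `δ_{√r}`
(`exists_compressed_pair`, `ε = r^{-1/4}`), nearest lattice points (`lattice_sandwich`), giving
`D ≥ κ (log r)^{min(δ,1)}` with `κ = min (1/(4C(1086 + 420Λ))) ((log 2427²)^{-δ})`,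
`Λ = 1500·(2·240+1)²(2·240²+1)`. [cite: CheegerKleinerNaor2011, §1.1 Thm. 1.1, Cor. 1.2 and
the deduction on arXiv p. 6] -/
theorem of_centralCollapse
    (H : ∃ δ : ℝ, 0 < δ ∧ ∃ C : ℝ, 0 < C ∧ ∀ (N : ℕ) (φ : HeisK → Fin N → ℝ),
      (∀ x ∈ Metric.ball (1 : HeisK) 1, ∀ y ∈ Metric.ball (1 : HeisK) 1,
        ∑ k, |φ x k - φ y k| ≤ dist x y) →
      ∀ ε : ℝ, 0 < ε → ε < 1 / 4 →
        ∃ x ∈ Metric.ball (1 : HeisK) 1, ∃ y ∈ Metric.ball (1 : HeisK) 1,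
          ε ≤ C * dist x y ∧
          ∑ k, |φ x k - φ y k| ≤ C * dist x y / Real.log (1 / ε) ^ δ) :
    CheegerKleinerNaor2011_wordBall_l1Distortion := by
  obtain ⟨δ₀, hδ₀, C, hC, H⟩ := H
  -- Step 0: we may take `δ ≤ 1`.
  set δ : ℝ := min δ₀ 1 with hδdef
  have hδ : 0 < δ := lt_min hδ₀ one_pos
  have hδ1 : δ ≤ 1 := min_le_right _ _
  have H' := centralCollapse_mono (min_le_left δ₀ 1) H
  -- constants
  set A : ℝ := C * (1086 + 420 * (1500 * ((2 * 240 + 1) ^ 2 * (2 * 240 ^ 2 + 1) : ℕ))) with hA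
  have hApos : 0 < A := by rw [hA]; positivity
  set Q : ℝ := Real.log ((2427 : ℝ) ^ 2) ^ δ with hQ
  have hQpos : 0 < Q := Real.rpow_pos_of_pos (Real.log_pos (by norm_num)) _
  refine ⟨δ, hδ, min (1 / (4 * A)) (1 / Q), by positivity, ?_⟩
  intro r hr N f D hf
  -- `D ≥ 1` from the pair `1, a`.
  have hD1 : 1 ≤ D := by
    have h := hf (0, 0, 0) (1, 0, 0) (zero_mem_wordBall r) (genA_mem_wordBall (by omega))
    rw [dist_zero_genA, Nat.cast_one, mul_one] at h
    exact h.1.trans h.2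
  have hr1 : (1 : ℝ) ≤ r := by exact_mod_cast (by omega : 1 ≤ r)
  have hlogr : 0 ≤ Real.log r := Real.log_nonneg hr1
  by_cases hsmall : (r : ℝ) < 2427 ^ 2
  · -- small radii: `κ (log r)^δ ≤ (log r₀)^δ / Q = 1 ≤ D`
    calc min (1 / (4 * A)) (1 / Q) * Real.log r ^ δ ≤ (1 / Q) * Q := by
          refine mul_le_mul (min_le_right _ _) ?_ (Real.rpow_nonneg hlogr _) (by positivity)
          exact Real.rpow_le_rpow hlogr (Real.log_le_log (by linarith) hsmall.le) hδ.le
      _ = 1 := by field_simp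
      _ ≤ D := hD1
  rw [not_lt] at hsmall
  have hlarge := large_radius hδ1 hC H' hsmall hf hD1
  -- `(log t)^δ = (¼ log r)^δ ≥ ¼ (log r)^δ`, `t = r^{1/4}`
  have hr_pos : (0 : ℝ) < r := by linarith
  have hlogt : Real.log (Real.sqrt (Real.sqrt r)) = (1 / 4) * Real.log r := by
    have h1 : (Real.sqrt (Real.sqrt r)) ^ 4 = r := by
      rw [show (4 : ℕ) = 2 * 2 by norm_num, pow_mul, Real.sq_sqrt (Real.sqrt_nonneg _),
        Real.sq_sqrt hr_pos.le]
    have h2 : Real.log ((Real.sqrt (Real.sqrt r)) ^ 4) = 4 * Real.log (Real.sqrt (Real.sqrt r)) := by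
      rw [Real.log_pow]; norm_num
    rw [h1] at h2
    linarith
  have hP_ge : (1 / 4) * Real.log r ^ δ ≤ Real.log (Real.sqrt (Real.sqrt r)) ^ δ := by
    rw [hlogt, Real.mul_rpow (by norm_num) hlogr]
    refine mul_le_mul_of_nonneg_right ?_ (Real.rpow_nonneg hlogr _)
    calc (1 / 4 : ℝ) = (1 / 4) ^ (1 : ℝ) := (Real.rpow_one _).symm
      _ ≤ (1 / 4) ^ δ := Real.rpow_le_rpow_of_exponent_ge (by norm_num) (by norm_num) hδ1
  calc min (1 / (4 * A)) (1 / Q) * Real.log r ^ δ ≤ (1 / (4 * A)) * Real.log r ^ δ :=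
        mul_le_mul_of_nonneg_right (min_le_left _ _) (Real.rpow_nonneg hlogr _)
    _ = (1 / A) * ((1 / 4) * Real.log r ^ δ) := by ring
    _ ≤ (1 / A) * (A * D) := mul_le_mul_of_nonneg_left (hP_ge.trans hlarge) (by positivity)
    _ = D := by field_simp

end CheegerKleinerNaor2011_wordBall_l1Distortion

end Literature.Geometry.MetricEmbeddings

end
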